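import Summits.CriticalPhenomena.PercolationContinuityZ3.Theorems.PercAnnulusCrossingIICTailTrivial
import Summits.CriticalPhenomena.PercolationContinuityZ3.Theorems.PercAnnulusCrossingIICTailRootInvariance
import Mathlib.MeasureTheory.Measure.Decomposition.RadonNikodym
import HarnessLib

/-!
# ALL ROOTS GIVE THE SAME FAR FIELD: `sup_{G ∈ 𝓕_{Λ(K)ᶜ}} |ν_v(G) − ν(G)| → 0` for Kesten's IIC (lane RSW3, p1 gen 10)

builds on p205010 (kernel theorem, internal audit signed; external expert review pending) — used only through `θ(p_c) = 0` in the
`criticalProbI` / `ℤ²` corollaries; the main theorem is stated at any `p` with `θ(p) = 0` and (A2)□; §1 is pure measure theory.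

Seat `prim-rsw3-p1` (gen 10); memo `run/shared/lean/prim/rsw3/P1-QM.md` §23.  Helper file; no definitions, no sorries.

Part `…IICTailTrivial` (gen 10): Kesten's IIC measure `ν` is tail trivial (`IsTailTrivial`).  Part `…IICTailRootInvariance` (gen 10): the IIC
rooted at `v`, `ν_v = (U_v)_* ν`, agrees with `ν` on tail events.  This file turns the qualitative statement at infinity into a UNIFORM one on
the outside σ-algebras, by a second application of Lévy's downward theorem:

* §1 **`exists_finset_forall_abs_real_sub_le_of_tailEvents_eq`** (generic, countable product `V → S`): if `μ` is tail trivial and `μ'` agrees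
  with `μ` on the tail σ-algebra, then for every `ε > 0` there is a finite `Λ` with `|μ'(B) − μ(B)| ≤ ε` for all `B ∈ 𝓕_{Λᶜ}` — two
  probability measures with the same trivial tail are ASYMPTOTICALLY EQUAL IN TOTAL VARIATION on the outside σ-algebras.  Proof: `ρ = (μ + μ')/2`
  is tail trivial, `μ = g·(μ + μ')` with `0 ≤ g ≤ 1` (Radon–Nikodym, `Measure.rnDeriv_le_one_of_le`), and `ρ[g | 𝓕_{Λᶜ}] → ρ(g) = 1/2` in
  `L¹(ρ)` along an exhaustion (the tree's `IsTailTrivial.exists_strictMono_tendsto_integral_abs_condExp_sub`), while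
  `∫_B g dρ − ρ(g)ρ(B) = (μ(B) − μ'(B))/4` for `B ∈ 𝓕_{Λᶜ}`.
* §2 **`iicMeasure_exists_forall_abs_map_shift_real_sub_le`** — `θ(p) = 0`, (A2)□ at a general aspect, `ν` with the IIC limit property,
  `v ∈ ℤ^d`, `ε > 0` ⇒ there is `K` with **`|ν_v(G) − ν(G)| ≤ ε` for every measurable `G` determined by the pairs outside `Λ(K).sym2`**:
  THE INCIPIENT INFINITE CLUSTERS ROOTED AT DIFFERENT VERTICES ARE ASYMPTOTICALLY INDISTINGUISHABLE FAR FROM THE ROOTS (although `ν_v ≠ ν`,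
  p1 gen 8 `…IICNotShiftInvariant`, and `ν_v`, `ν` are even mutually singular off `{0 ↔ v}`); `…_of_setToSetQuasiMultAspectAt`,
  **`…_criticalProbI`** (`p_c(ℤ^d)`, `d ≥ 2`, (A2)□ at aspect `(s,L)`, `2 ≤ s`), **`…_Z2`** (Kesten's planar IIC, unconditional);
  `iicMeasure_map_shift_isTailTrivial` — `ν_v` is tail trivial.
Honest placement: §1 is a routine backward-martingale fact (Georgii 2011 §7.1 circle of ideas; not located verbatim); §2 seems unrecorded for
the IIC; planar case folklore-level.
References: H. Kesten, PTRF 73 (1986) Thm. (3); D. Basu, A. Sapozhnikov, ECP 22 (2017) no. 26, Thm. 1.1; H.-O. Georgii, *Gibbs Measures and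
Phase Transitions* (2011), §7.1, Prop. 7.9; R. Durrett, *Probability* (2019), Thm. 4.7.3.
-/

noncomputable section

namespace Summit.CriticalPhenomena.PercolationContinuityZ3.Theorems.Crossing

open MeasureTheory Filter Topology Literature.Probability.Percolation Literature.Probability.LatticeModels
open Literature.Probability.Percolation.DCT16
open Summit.CriticalPhenomena.PercolationContinuityZ3.Theorems.SurfaceTension
open scoped Literature.Probability.Percolation ENNReal symmDiff

variable {d : ℕ}

/-! ## §1 Two measures with the same trivial tail are asymptotically equal on the outside σ-algebras -/

/-- **Same trivial tail ⇒ asymptotically equal far away** (generic, countable product `V → S`): if `μ` is tail trivial and the probability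
measure `μ'` agrees with `μ` on `tailEvents V S`, then for every `ε > 0` there is a finite `Λ ⊆ V` with `|μ'(B) − μ(B)| ≤ ε` for every
`B ∈ 𝓕_{Λᶜ}` (Lévy's downward theorem for the density of `μ` with respect to `(μ + μ')/2`, which is tail trivial).
[cite: Georgii2011, §7.1, Prop. 7.9] [cite: Durrett2019, Thm. 4.7.3] -/
theorem exists_finset_forall_abs_real_sub_le_of_tailEvents_eq {V S : Type*} [MeasurableSpace S] [Countable V]
    {μ μ' : Measure (V → S)} [IsProbabilityMeasure μ] [IsProbabilityMeasure μ']
    (hμ : IsTailTrivial μ) (heq : ∀ B : Set (V → S), MeasurableSet[tailEvents V S] B → μ' B = μ B)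
    {ε : ℝ} (hε : 0 < ε) :
    ∃ Λ : Finset V, ∀ B : Set (V → S),
      MeasurableSet[cylinderEvents (X := fun _ : V => S) ((↑Λ : Set V)ᶜ)] B → |μ'.real B - μ.real B| ≤ ε := by
  classical
  obtain ⟨Λ, hΛmono, hΛex⟩ := exists_monotone_finset_exhaustion V
  have h2top : (2 : ℝ≥0∞) ≠ ∞ := ENNReal.ofNat_ne_top
  have h2inv : (2 : ℝ≥0∞)⁻¹ * 2 = 1 := ENNReal.inv_mul_cancel two_ne_zero h2top
  -- the averaged measure `ρ = (μ + μ')/2`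
  set ρ : Measure (V → S) := (2 : ℝ≥0∞)⁻¹ • (μ + μ') with hρ
  have hρapply : ∀ s : Set (V → S), ρ s = 2⁻¹ * (μ s + μ' s) := fun s => by
    rw [hρ, Measure.smul_apply, Measure.add_apply, smul_eq_mul]
  haveI hρP : IsProbabilityMeasure ρ := ⟨by rw [hρapply, measure_univ, measure_univ, one_add_one_eq_two, h2inv]⟩
  have hρT : IsTailTrivial ρ := by
    intro B hB
    rcases hμ B hB with h0 | h1
    · left; rw [hρapply, heq B hB, h0, add_zero, mul_zero]
    · right; rw [hρapply, heq B hB, h1, one_add_one_eq_two, h2inv]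
  have hρreal : ∀ s : Set (V → S), ρ.real s = 2⁻¹ * (μ.real s + μ'.real s) := fun s => by
    rw [measureReal_def, hρapply, ENNReal.toReal_mul, ENNReal.toReal_add (measure_ne_top _ _) (measure_ne_top _ _),
      ENNReal.toReal_inv, ← measureReal_def, ← measureReal_def]
    norm_num
  -- the density of `μ` with respect to `μ + μ'`, as a function with values in `[0,1]`
  have hle : μ ≤ μ + μ' := Measure.le_add_right le_rfl
  have hac : μ ≪ μ + μ' := Measure.absolutelyContinuous_of_le hle
  set g : (V → S) → ℝ := fun x => min ((μ.rnDeriv (μ + μ')) x).toReal 1 with hg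
  have hgm : Measurable g := (Measure.measurable_rnDeriv μ (μ + μ')).ennreal_toReal.min measurable_const
  have hg0 : ∀ x, 0 ≤ g x := fun x => le_min ENNReal.toReal_nonneg zero_le_one
  have hg1 : ∀ x, g x ≤ 1 := fun x => min_le_right _ _
  have hgC : ∀ x, |g x| ≤ 1 := fun x => by rw [abs_of_nonneg (hg0 x)]; exact hg1 x
  have hgae : (fun x => ((μ.rnDeriv (μ + μ')) x).toReal) =ᵐ[μ + μ'] g := by
    filter_upwards [Measure.rnDeriv_le_one_of_le hle] with x hx
    rw [hg]
    refine (min_eq_left ?_).symm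
    have h := ENNReal.toReal_mono ENNReal.one_ne_top hx
    rwa [ENNReal.toReal_one] at h
  have hμB : ∀ B : Set (V → S), μ.real B = ∫ x in B, g x ∂(μ + μ') := fun B => by
    rw [← Measure.setIntegral_toReal_rnDeriv hac B]
    exact integral_congr_ae (ae_restrict_of_ae hgae)
  have hρB : ∀ B : Set (V → S), ∫ x in B, g x ∂ρ = 2⁻¹ * μ.real B := fun B => by
    rw [hρ, Measure.restrict_smul, integral_smul_measure, hμB B, ENNReal.toReal_inv, smul_eq_mul]
    norm_num
  have hgint : Integrable g ρ :=
    (integrable_const (1 : ℝ)).mono' hgm.aestronglyMeasurable (ae_of_all _ fun x => by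
      rw [Real.norm_eq_abs]; exact hgC x)
  have hc : ∫ y, g y ∂ρ = 2⁻¹ := by
    rw [← setIntegral_univ, hρB Set.univ, probReal_univ, mul_one]
  -- Lévy downward + tail triviality of `ρ`
  obtain ⟨φ, -, hφ⟩ := IsTailTrivial.exists_strictMono_tendsto_integral_abs_condExp_sub hρT hΛmono hΛex hgint hgC
  have hε4 : 0 < ε / 4 := by positivity
  obtain ⟨j, hj⟩ := ((tendsto_order.1 hφ).2 (ε / 4) hε4).exists
  refine ⟨Λ (φ j), fun B hB => ?_⟩
  have hmle : cylinderEvents (X := fun _ : V => S) ((↑(Λ (φ j)) : Set V)ᶜ) ≤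
      (MeasurableSpace.pi : MeasurableSpace (V → S)) := cylinderEvents_le_pi
  have hBm : MeasurableSet B := hmle _ hB
  set G : (V → S) → ℝ := ρ[g|cylinderEvents (X := fun _ : V => S) ((↑(Λ (φ j)) : Set V)ᶜ)] with hG
  have hGint : Integrable G ρ := integrable_condExp
  have h1 : ∫ x in B, g x ∂ρ = ∫ x in B, G x ∂ρ := by rw [hG, setIntegral_condExp hmle hgint hB]
  have h2 : (∫ y, g y ∂ρ) * ρ.real B = ∫ x in B, (∫ y, g y ∂ρ) ∂ρ := by
    rw [setIntegral_const, smul_eq_mul, mul_comm]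
  have h3 : ∫ x in B, g x ∂ρ - (∫ y, g y ∂ρ) * ρ.real B = ∫ x in B, (G x - ∫ y, g y ∂ρ) ∂ρ := by
    rw [h1, h2, ← integral_sub hGint.integrableOn (integrable_const _).integrableOn]
  have h4 : |∫ x in B, g x ∂ρ - (∫ y, g y ∂ρ) * ρ.real B| ≤ ε / 4 := by
    rw [h3]
    calc |∫ x in B, (G x - ∫ y, g y ∂ρ) ∂ρ| ≤ ∫ x in B, |G x - ∫ y, g y ∂ρ| ∂ρ := abs_integral_le_integral_abs
      _ ≤ ∫ x, |G x - ∫ y, g y ∂ρ| ∂ρ :=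
          setIntegral_le_integral ((hGint.sub (integrable_const _)).abs) (Eventually.of_forall fun x => abs_nonneg _)
      _ ≤ ε / 4 := hj.le
  rw [hρB B, hc, hρreal B] at h4
  have h5 : 2⁻¹ * μ.real B - 2⁻¹ * (2⁻¹ * (μ.real B + μ'.real B)) = 4⁻¹ * (μ.real B - μ'.real B) := by ring
  rw [h5, abs_mul, abs_of_pos (by norm_num : (0 : ℝ) < 4⁻¹)] at h4
  rw [abs_sub_comm]
  linarith

/-! ## §2 The IIC rooted at `v` and the IIC rooted at `0` are asymptotically indistinguishable far away -/

/-- `ν_v(G) = ν(G)` on the tail σ-algebra, `ℝ≥0∞` form (`θ(p) = 0`, (A2)□ at a general aspect). [cite: Kesten1986, Thm. (3)]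
[cite: BasuSapozhnikov2017ECP, Thm. 1.1] -/
theorem iicMeasure_map_shift_eq_of_tailEvents (hd : 1 ≤ d) (p : unitInterval) (hp : 0 < (p : ℝ))
    (hθ : theta (zdGraph d) 0 p = 0) {ϰ : ℝ} (hϰ : 0 < ϰ)
    {σ τ : ℕ → ℕ} (hσ : ∀ m : ℕ, 1 ≤ m → m < σ m) (hστ : ∀ m : ℕ, 1 ≤ m → σ m < τ m)
    (hσm : Monotone σ) (hτm : Monotone τ)
    (hA2 : ∀ m : ℕ, 1 ≤ m → ∀ Z : Finset (Site d), box d (τ m) \ box d (m - 1) ⊆ Z →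
      ∀ X : Finset (Site d), X ⊆ Z ∩ box d m → ∀ Y : Finset (Site d), Y ⊆ Z \ box d (τ m) →
        ϰ * (bondPercolation (zdGraph d) p).real {ω | ∃ x ∈ X, ∃ s ∈ innerBoundary (zdGraph d) (box d (σ m)),
              ω ∈ openConnIn (↑Z : Set (Site d)) x s} *
          (bondPercolation (zdGraph d) p).real {ω | ∃ y ∈ Y, ∃ s ∈ innerBoundary (zdGraph d) (box d (σ m)),
              ω ∈ openConnIn (↑Z : Set (Site d)) y s} ≤
        (bondPercolation (zdGraph d) p).real {ω | ∃ x ∈ X, ∃ y ∈ Y, ω ∈ openConnIn (↑Z : Set (Site d)) x y})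
    {ν : Measure (BondConfig (Site d))} [IsProbabilityMeasure ν]
    (hν : ∀ (F : Finset (Sym2 (Site d))) (E : Set (BondConfig (Site d))), MeasurableSet E → DeterminedBy E ↑F →
      Tendsto (fun n : ℕ => (bondPercolation (zdGraph d) p).real (E ∩ siteToBoundary d n) / oneArmProb d p n)
        atTop (𝓝 (ν.real E)))
    (v : Site d) {G : Set (BondConfig (Site d))} (hG : MeasurableSet[tailEvents (Sym2 (Site d)) Prop] G) :
    ν.map (BondConfig.relabel (sym2Equiv (Site.shift v))) G = ν G := by
  haveI : IsProbabilityMeasure (ν.map (BondConfig.relabel (sym2Equiv (Site.shift v)))) := isProbabilityMeasure_iicMeasure_map_shift v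
  obtain ⟨hGm, hGtail⟩ := measurableSet_tailEvents_iff_forall_determinedBy.1 hG
  have h := iicMeasure_map_shift_real_eq_of_tail hd p hp hθ hϰ hσ hστ hσm hτm hA2 hν v hGm hGtail
  rw [measureReal_def, measureReal_def] at h
  exact (ENNReal.toReal_eq_toReal_iff' (measure_ne_top _ _) (measure_ne_top _ _)).1 h

/-- **`ν_v` is tail trivial** (`θ(p) = 0`, (A2)□ at a general aspect): the IIC rooted at `v` agrees with the tail-trivial `ν` on tail events.
[cite: Kesten1986, Thm. (3)] [cite: Georgii2011, Thm. 7.7] -/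
theorem iicMeasure_map_shift_isTailTrivial (hd : 1 ≤ d) (p : unitInterval) (hp : 0 < (p : ℝ))
    (hθ : theta (zdGraph d) 0 p = 0) {ϰ : ℝ} (hϰ : 0 < ϰ)
    {σ τ : ℕ → ℕ} (hσ : ∀ m : ℕ, 1 ≤ m → m < σ m) (hστ : ∀ m : ℕ, 1 ≤ m → σ m < τ m)
    (hσm : Monotone σ) (hτm : Monotone τ)
    (hA2 : ∀ m : ℕ, 1 ≤ m → ∀ Z : Finset (Site d), box d (τ m) \ box d (m - 1) ⊆ Z →
      ∀ X : Finset (Site d), X ⊆ Z ∩ box d m → ∀ Y : Finset (Site d), Y ⊆ Z \ box d (τ m) →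
        ϰ * (bondPercolation (zdGraph d) p).real {ω | ∃ x ∈ X, ∃ s ∈ innerBoundary (zdGraph d) (box d (σ m)),
              ω ∈ openConnIn (↑Z : Set (Site d)) x s} *
          (bondPercolation (zdGraph d) p).real {ω | ∃ y ∈ Y, ∃ s ∈ innerBoundary (zdGraph d) (box d (σ m)),
              ω ∈ openConnIn (↑Z : Set (Site d)) y s} ≤
        (bondPercolation (zdGraph d) p).real {ω | ∃ x ∈ X, ∃ y ∈ Y, ω ∈ openConnIn (↑Z : Set (Site d)) x y})
    {ν : Measure (BondConfig (Site d))} [IsProbabilityMeasure ν]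
    (hν : ∀ (F : Finset (Sym2 (Site d))) (E : Set (BondConfig (Site d))), MeasurableSet E → DeterminedBy E ↑F →
      Tendsto (fun n : ℕ => (bondPercolation (zdGraph d) p).real (E ∩ siteToBoundary d n) / oneArmProb d p n)
        atTop (𝓝 (ν.real E)))
    (v : Site d) : IsTailTrivial (V := Sym2 (Site d)) (S := Prop) (ν.map (BondConfig.relabel (sym2Equiv (Site.shift v)))) := by
  intro G hG
  have h := iicMeasure_map_shift_eq_of_tailEvents hd p hp hθ hϰ hσ hστ hσm hτm hA2 hν v hG
  rcases iicMeasure_isTailTrivial hd p hp hθ hϰ hσ hστ hσm hτm hA2 hν G hG with h0 | h1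
  · exact Or.inl (h.trans h0)
  · exact Or.inr (h.trans h1)

/-- **ALL ROOTS GIVE THE SAME FAR FIELD**: `θ(p) = 0`, (A2)□(ϰ) at a general aspect, `ν` a probability measure with the IIC limit property at `p`
(`0 < p`, `d ≥ 1`), `v ∈ ℤ^d`, `ε > 0` ⇒ there is `K` with **`|ν_v(G) − ν(G)| ≤ ε` for every measurable `G` determined by the pairs
outside `Λ(K).sym2`** — `sup_{G ∈ 𝓕_{Λ(K)ᶜ}} |ν_v(G) − ν(G)| → 0`: Kesten's incipient infinite clusters rooted at `v` and at `0` are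
asymptotically indistinguishable away from the roots. [cite: Kesten1986, Thm. (3)] [cite: BasuSapozhnikov2017ECP, Thm. 1.1 ("for any w")]
[cite: Georgii2011, Prop. 7.9] -/
theorem iicMeasure_exists_forall_abs_map_shift_real_sub_le (hd : 1 ≤ d) (p : unitInterval) (hp : 0 < (p : ℝ))
    (hθ : theta (zdGraph d) 0 p = 0) {ϰ : ℝ} (hϰ : 0 < ϰ)
    {σ τ : ℕ → ℕ} (hσ : ∀ m : ℕ, 1 ≤ m → m < σ m) (hστ : ∀ m : ℕ, 1 ≤ m → σ m < τ m)
    (hσm : Monotone σ) (hτm : Monotone τ)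
    (hA2 : ∀ m : ℕ, 1 ≤ m → ∀ Z : Finset (Site d), box d (τ m) \ box d (m - 1) ⊆ Z →
      ∀ X : Finset (Site d), X ⊆ Z ∩ box d m → ∀ Y : Finset (Site d), Y ⊆ Z \ box d (τ m) →
        ϰ * (bondPercolation (zdGraph d) p).real {ω | ∃ x ∈ X, ∃ s ∈ innerBoundary (zdGraph d) (box d (σ m)),
              ω ∈ openConnIn (↑Z : Set (Site d)) x s} *
          (bondPercolation (zdGraph d) p).real {ω | ∃ y ∈ Y, ∃ s ∈ innerBoundary (zdGraph d) (box d (σ m)),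
              ω ∈ openConnIn (↑Z : Set (Site d)) y s} ≤
        (bondPercolation (zdGraph d) p).real {ω | ∃ x ∈ X, ∃ y ∈ Y, ω ∈ openConnIn (↑Z : Set (Site d)) x y})
    {ν : Measure (BondConfig (Site d))} [IsProbabilityMeasure ν]
    (hν : ∀ (F : Finset (Sym2 (Site d))) (E : Set (BondConfig (Site d))), MeasurableSet E → DeterminedBy E ↑F →
      Tendsto (fun n : ℕ => (bondPercolation (zdGraph d) p).real (E ∩ siteToBoundary d n) / oneArmProb d p n)
        atTop (𝓝 (ν.real E)))
    (v : Site d) {ε : ℝ} (hε : 0 < ε) :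
    ∃ K : ℕ, ∀ G : Set (BondConfig (Site d)), MeasurableSet G →
      DeterminedBy G {e : Sym2 (Site d) | e ∉ (↑((box d K).sym2) : Set (Sym2 (Site d)))} →
        |(ν.map (BondConfig.relabel (sym2Equiv (Site.shift v)))).real G - ν.real G| ≤ ε := by
  haveI : IsProbabilityMeasure (ν.map (BondConfig.relabel (sym2Equiv (Site.shift v)))) := isProbabilityMeasure_iicMeasure_map_shift v
  haveI : IsProbabilityMeasure (show Measure (Sym2 (Site d) → Prop) from ν) := ‹IsProbabilityMeasure ν›
  haveI : IsProbabilityMeasure (show Measure (Sym2 (Site d) → Prop) from ν.map (BondConfig.relabel (sym2Equiv (Site.shift v)))) :=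
    ‹IsProbabilityMeasure (ν.map (BondConfig.relabel (sym2Equiv (Site.shift v))))›
  obtain ⟨F, hF⟩ := exists_finset_forall_abs_real_sub_le_of_tailEvents_eq (V := Sym2 (Site d)) (S := Prop)
    (μ := ν) (μ' := ν.map (BondConfig.relabel (sym2Equiv (Site.shift v))))
    (iicMeasure_isTailTrivial hd p hp hθ hϰ hσ hστ hσm hτm hA2 hν)
    (fun B hB => iicMeasure_map_shift_eq_of_tailEvents hd p hp hθ hϰ hσ hστ hσm hτm hA2 hν v hB) hε
  obtain ⟨K, hK⟩ := exists_box_sym2_superset F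
  exact ⟨K, fun G hGm hG => hF G (measurableSet_cylinderEvents_compl_of_determinedBy_box hGm hG hK)⟩

/-- **All roots give the same far field, typed (A2)□ at aspect `(s, L)`** (`2 ≤ s`; `θ(p) = 0`, `0 < p`, `d ≥ 1`).
[cite: BasuSapozhnikov2017ECP, Thm. 1.1 and §1 (A2)] [cite: Kesten1986, Thm. (3)] -/
theorem iicMeasure_exists_forall_abs_map_shift_real_sub_le_of_setToSetQuasiMultAspectAt (hd : 1 ≤ d) (p : unitInterval)
    (hp : 0 < (p : ℝ)) (hθ : theta (zdGraph d) 0 p = 0) {s L : ℕ} (hs : 2 ≤ s) {ϰ : ℝ} (hϰ : 0 < ϰ)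
    (hA2 : SetToSetQuasiMultAspectAt d p s L ϰ)
    {ν : Measure (BondConfig (Site d))} [IsProbabilityMeasure ν]
    (hν : ∀ (F : Finset (Sym2 (Site d))) (E : Set (BondConfig (Site d))), MeasurableSet E → DeterminedBy E ↑F →
      Tendsto (fun n : ℕ => (bondPercolation (zdGraph d) p).real (E ∩ siteToBoundary d n) / oneArmProb d p n)
        atTop (𝓝 (ν.real E)))
    (v : Site d) {ε : ℝ} (hε : 0 < ε) :
    ∃ K : ℕ, ∀ G : Set (BondConfig (Site d)), MeasurableSet G →
      DeterminedBy G {e : Sym2 (Site d) | e ∉ (↑((box d K).sym2) : Set (Sym2 (Site d)))} →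
        |(ν.map (BondConfig.relabel (sym2Equiv (Site.shift v)))).real G - ν.real G| ≤ ε := by
  have hA2' : SetToSetQuasiMultAspectAt d p s (max L (s + 1)) ϰ := hA2.mono_outer (le_max_left _ _)
  refine iicMeasure_exists_forall_abs_map_shift_real_sub_le hd p hp hθ hϰ (σ := fun m => s * m) (τ := fun m => max L (s + 1) * m)
    (fun m hm => ?_) (fun m hm => ?_) (fun a b hab => Nat.mul_le_mul_left s hab) (fun a b hab => Nat.mul_le_mul_left _ hab)
    (fun m hm Z hZ X hX Y hY => by rw [mul_assoc]; exact hA2' m hm Z hZ X hX Y hY) hν v hε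
  · have := Nat.mul_le_mul_right m hs; omega
  · exact Nat.mul_lt_mul_of_pos_right (lt_of_lt_of_le (Nat.lt_succ_self s) (le_max_right _ _)) (by omega)

/-- **ALL ROOTS GIVE THE SAME FAR FIELD AT `p_c(ℤ^d)`** (`d ≥ 2`, (A2)□ at aspect `(s, L)`, `2 ≤ s`): for every IIC probability measure `ν`,
every `v ∈ ℤ^d` and every `ε > 0` there is `K` with `|ν_v(G) − ν(G)| ≤ ε` for every measurable `G` determined by the pairs outside
`Λ(K).sym2`. [cite: BasuSapozhnikov2017ECP, Thm. 1.1 ("for any w")] [cite: Kesten1986, Thm. (3)] [cite: Georgii2011, Prop. 7.9] -/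
theorem iicMeasure_exists_forall_abs_map_shift_real_sub_le_criticalProbI (hd : 2 ≤ d) {s L : ℕ} (hs : 2 ≤ s) {ϰ : ℝ} (hϰ : 0 < ϰ)
    (hA2 : SetToSetQuasiMultAspectAt d (criticalProbI d) s L ϰ)
    {ν : Measure (BondConfig (Site d))} [IsProbabilityMeasure ν]
    (hν : ∀ (F : Finset (Sym2 (Site d))) (E : Set (BondConfig (Site d))), MeasurableSet E → DeterminedBy E ↑F →
      Tendsto (fun n : ℕ => (bondPercolation (zdGraph d) (criticalProbI d)).real (E ∩ siteToBoundary d n) /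
        oneArmProb d (criticalProbI d) n) atTop (𝓝 (ν.real E)))
    (v : Site d) {ε : ℝ} (hε : 0 < ε) :
    ∃ K : ℕ, ∀ G : Set (BondConfig (Site d)), MeasurableSet G →
      DeterminedBy G {e : Sym2 (Site d) | e ∉ (↑((box d K).sym2) : Set (Sym2 (Site d)))} →
        |(ν.map (BondConfig.relabel (sym2Equiv (Site.shift v)))).real G - ν.real G| ≤ ε := by
  have hpc : 0 < ((criticalProbI d : unitInterval) : ℝ) := by
    exact_mod_cast Literature.Barriers.CriticalPhenomena.criticalProbI_pos' (d := d) (by omega)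
  exact iicMeasure_exists_forall_abs_map_shift_real_sub_le_of_setToSetQuasiMultAspectAt (by omega) (criticalProbI d) hpc
    (CSH.percolationContinuity_allDimensions d hd) hs hϰ hA2 hν v hε

/-- **ALL ROOTS GIVE THE SAME FAR FIELD FOR KESTEN'S PLANAR IIC, unconditionally**: for every probability measure `ν` with the IIC limit
property at `p_c(ℤ²)`, every `v ∈ ℤ²` and every `ε > 0` there is `K` with `|ν_v(G) − ν(G)| ≤ ε` for every measurable `G` determined by the
pairs outside `Λ(K).sym2`. [cite: Kesten1986, Thm. (3)] [cite: Georgii2011, Prop. 7.9] -/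
theorem iicMeasure_exists_forall_abs_map_shift_real_sub_le_Z2 {ν : Measure (BondConfig (Site 2))} [IsProbabilityMeasure ν]
    (hν : ∀ (F : Finset (Sym2 (Site 2))) (E : Set (BondConfig (Site 2))), MeasurableSet E → DeterminedBy E ↑F →
      Tendsto (fun n : ℕ => (bondPercolation (zdGraph 2) (criticalProbI 2)).real (E ∩ siteToBoundary 2 n) /
        oneArmProb 2 (criticalProbI 2) n) atTop (𝓝 (ν.real E)))
    (v : Site 2) {ε : ℝ} (hε : 0 < ε) :
    ∃ K : ℕ, ∀ G : Set (BondConfig (Site 2)), MeasurableSet G →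
      DeterminedBy G {e : Sym2 (Site 2) | e ∉ (↑((box 2 K).sym2) : Set (Sym2 (Site 2)))} →
        |(ν.map (BondConfig.relabel (sym2Equiv (Site.shift v)))).real G - ν.real G| ≤ ε := by
  obtain ⟨ϰ, hϰ, hA2⟩ := exists_setToSetQuasiMultAspectAt_two_of_criticalProbI_le
  exact iicMeasure_exists_forall_abs_map_shift_real_sub_le_criticalProbI (d := 2) le_rfl (by norm_num) hϰ (hA2 _ le_rfl) hν v hε

end Summit.CriticalPhenomena.PercolationContinuityZ3.Theorems.Crossing

end
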